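import Summits.HodgeConjecture.HodgeConjecture.Theorems.HCCMUnconditionalOfGenericFloorV7
import Summits.HodgeConjecture.HodgeConjecture.Theorems.HCCMUnconditionalH413OfFacts
import Summits.HodgeConjecture.CorCM.Hyp413.A3Liu413FaceTypes
import Summits.HodgeConjecture.HodgeConjecture.Theorems.H413CuspCotPin
import Summits.HodgeConjecture.HodgeConjecture.Theorems.H413CohFormsCarriersLemmas
import Summits.HodgeConjecture.HodgeConjecture.Theorems.H413TowerConj
import Summits.HodgeConjecture.HodgeConjecture.Theorems.F0P2aStubsB1aB1bB3Holds  -- ED. 2: ★ B1a ∕ B1b ∕ B3 closers (F0P2a-p08 (g0))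
import Summits.HodgeConjecture.HodgeConjecture.Theorems.P4aStubM3CohClassMapWithFormulas  -- ED. 2: ★ B4 closer (A-p12 (g12))
-- import Summits.HodgeConjecture.HodgeConjecture.Cruxes.H413.Lines.F0_P2CohSpectrumL2  -- ← the intended import (P2's U1′/U2ℓ/U2a/E2E2b/U4 + `H413_of_split` BY NAME); farm snapshot 11669 has it UNBUILT (lean check rc 75 `remote:stale:11669:unbuilt:…F0_P2CohSpectrumL2`, 2026-08-30T21:58Z): switch = uncomment, delete the pasted §0 types below and replace `hrest` by `fun h1 => P2CohSpectrumL2.oscillatorTriple_dictionaryExistence_holds_of_split h1 hl ha he h4`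
import HarnessLib

-- ED. 2 registrar pass (A-plan1 (g18), 2026-08-30T23:5xZ): (i) D-CITE key rename «Deligne1971HodgeII → DeligneHodgeII1971» ×6 (lit1 (g14)
-- 22:34:57Z; docstrings only); (ii) director s355 cure — every `[cite: …]` tag inside a socket-`def` docstring rewritten as prose `(print: …)`;
-- theorem tags kept; declarations byte-identical to F0P2a-p08 (g0) bytes b6ab3c18a67904c3.

/-!
# F0-P2aHodgeRealisation — the B4-ARCHIMEDEAN DESK LINE of FLOOR 0: `cohForms 𝔞₀(V) ≅ H¹_{B,τ'}(A_∞, ℂ)`, `U(V)(𝔸_{F⁺,f})`-equivariantly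
# (Matsushima–Hodge at the pin), serving P2-U1′ (`StubU1RealisationAt`), P3/U3-S1 (`StubS1HodgeMatsushimaDecAt`) and P4-T2 (`StubT2MatsushimaHodgeAt`) BY NAME

Cell hodgecm-mathlib (D-0151), FLOOR 0, crux item H413 = stmt-HodgeConjecture-24833 (`HCCMUnconditional.H413`); sub-programme P2a «archimedean side»
(planner F0P2a-plan (g0), 2026-08-30; parent F0P2-plan).  HC_CM is proved only modulo the printed citations until rung 0 closes; this file proves
nothing about them.

THE ONE DESK THEOREM.  Three registered consumers ask for the same archimedean statement in three shapes: P2-U1′ (an INJECTIVE equivariant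
realisation `H¹_{B,τ'} → cohForms 𝔞₀`), U3-S1 (the same, `3 ≤ n`), P4-T2 (an INJECTIVE equivariant class map `cohForms 𝔞₀ → H¹_{B,τ'}`).  All three are
corollaries of ONE statement: the class map is a `U(V)(𝔸_{F⁺,f})`-equivariant ISOMORPHISM `cls : cohForms 𝔞₀ ≅ H¹_{B,τ'}` (`dec = cls⁻¹`).  Its
holomorphic half is IN THE TREE: ★ `CuspCot.clsHol` (`Theorems/H413CuspCotClassMap`: linear, injective, equivariant) with values in the `(1,0)`-part of
the tower (★ `CuspCot.clsHol_mem_hodge10Part`, `Theorems/H413CuspCotPin`; = P4-T2a ★ `t2a_holClassMapAt`).  What is NOT in the tree is SURJECTIVITY and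
the `(0,1)` half.  While this line was being cut, A-p19 landed the TOWER CONJUGATION and the OPPOSEDNESS of the `(1,0)`-part (★ p791712
`Theorems/H413TowerConj`: `conjT`, `H10T`, `eq_zero_of_mem_H10T_of_conjT_eq`; P4-T2b closed) and A-p08 the injective `(1,0) ⊕ (0,1)` extension (★ p791720, P4-T2c closed) — they
are used BY NAME here, never re-stubbed.  What remains of the desk is cut into FOUR stubs, each in the currency of A-p13's ∕ A-p19's tower files:

* B1a `StubB1aLevelFamiliesOnto` (M, the hardest) — levelwise Matsushima SURJECTIVITY on the regime model: every level-`Γ` family of `(1,0)`-classes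
  `c ∈ towerLevel Γ`, `c h ∈ F¹H¹(P_{Γ_h})`, is the cohomological family `towerFamily G` of a saturated cuspidal cotangent form `G ∈ cuspCotSat V hV Γ.K`
  (glue the harmonic `(1,0)`-representatives `classMapDatumOf.pull (c h)` over the double cosets; inverse of ★ `comp`/`compClass`).
* B1b `StubB1bRegimeFormsTransportBack` (S–M) — the converse of ★ `toRegimeFun_mem_cuspCotSat`: every `G ∈ cuspCotSat V hV K` (`K` open) is
  `toRegimeFun f` of an adelic `f ∈ holCotForms (archFactorOf F V)`.
  (B1a + B1b + ★ ⟹ `LinearMap.range clsHol = H10T`, theorem `range_clsHol_eq_H10T_of` below.)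
* B3 `StubB3TowerHodgeSpanning` (M⁻) — the SPANNING half of the Hodge decomposition of the tower in degree one: `Tower = H10T + conjT H10T`
  (weight-one ★ `HodgeStructure.isCompl_F_complexConj 1 1` levelwise; transitions preserve `F¹`, ★ `TowerConj.trPull_mem_F`, and commute with `conj`, ★ `TowerConj.conj_trPull`).
* B4 `StubB4CohIsoOfParts` (S–M, generic carrier algebra) — an injective equivariant `cls₁₀ : holCotForms 𝔞₀ → H` with range `P` and an involutive
  equivariant conjugate-linear `cT` with `P ∩ cT P = 0`, `P + cT P = H` give an equivariant BIJECTIVE `cls : cohForms 𝔞₀ → H` extending `cls₁₀`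
  (`cls (f + conjFun f') = cls₁₀ f + cT (cls₁₀ f')` — the construction of ★ `P4StubT2cCohClassMapOfHol.exists_cohClassMap_of_hol` with its formula exported, plus surjectivity).
* L5 `DecOfIso` (S, generic, PROVED in-file as `decOfIso` — not a stub) — a bijective equivariant `cls : cohForms 𝔞₀ → H` inverts to an injective equivariant
  `dec : H → (U(V)(𝔸_{F⁺}) → ℂ²)` with values in `cohForms 𝔞₀` (★ `IsHonest.rightRep_mem_cohForms`, ★ `archFactorOf_isHonest`).

HEADS (kernel-checked, no `sorry` in their own terms): `range_clsHol_eq_H10T_of : B1a → B1b → range clsHol = H10T`;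
`exists_cohClassIso_tower_of : B1a → B1b → B3 → B4 → (∃ cls : cohForms 𝔞₀ →ₗ Tower, bijective ∧ act-equivariant ∧ extends clsHol)` (any record), and at the pin
`exists_cohClassIso_pin_of : … → (∀ face τ', ∃ cls : cohForms 𝔞₀ →ₗ H¹_{B,τ'} bijective ∧ rhoB-equivariant)`, `exists_dec_pin_of` (the inverse);
`stubT2_of : B1a → B1b → B3 → B4 → StubT2MatsushimaHodgeAt` (P4, pasted token-identically from `Lines/F0_P4AdmissibleOccursInH1.lean` :155–165);
`stubS1_of : B1a → B1b → B3 → B4 → StubS1HodgeMatsushimaDecAt` (U3, pasted token-identically from `Lines/F0_U3CohMultOne.lean` :163–171);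
`stubU1_of : B1a → B1b → B3 → B4 → StubU1RealisationAt` (P2, pasted token-identically from `Lines/F0_P2CohSpectrumL2.lean` :402–407 with `RealisedIn` :201–203);
`H413_of_F0P2a : B-stubs → (StubU1RealisationAt → HdictEType) → HJ3aType → HoccType → HCCMUnconditional.H413` (the crux decl BY NAME, via A-p07's ★
`Hyp413Closing.H413_of_three_facts_flat`; the middle binder is P2's ★ `oscillatorTriple_dictionaryExistence_holds_of_split` partially applied to its U2ℓ/U2a/E2E2b/U4 —
one binder instead of an import only because `Lines/F0_P2CohSpectrumL2` is unbuilt in tonight's farm snapshot, rc 75).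

Registration: `ledger crux write stmt-HodgeConjecture-24833 Lines/F0-P2aHodgeRealisation.lean` only — NO `ledger skeleton check … --crux` (director
s335/s343: the served stub set of the crux is `a3_liu413` v10.2; the payload wording «skeleton check» is superseded by the director's ruling).
[cite: BorelWallach2000, VII 2.10, VII 3.2, VII 3.6; XIII 1.2] [cite: VoisinHodgeI2002, Prop. 6.11, Cor. 7.6, §7.1] [cite: DeligneHodgeII1971, 1.2.5, 2.1.4]
[cite: Borel1997, §5.14] [cite: BorelJacquet1979, §4.1–§4.2] [cite: MatsushimaMurakami1963, §4] [cite: Liu2021, proof of Prop. 4.13, l. 2121–2146]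

## ED. 2 (F0P2a-p08 (g0), fold hand of the B4 desk per director s364 ∕ s378; registrar A-plan1) — THE FOUR STUBS ARE CLOSED BY NAME; `sorry` count 4 → 0
Every declaration below is byte-identical to ed. 1 (commit 87131109ee02, sha16 817ccb29688d3017) EXCEPT the four stub theorems of §3, whose `sorry`
bodies are replaced by the ★ closers (types = the stub `def` bodies token for token, so each fold is a one-liner):
* `stub_B1a_levelFamiliesOnto := F0P2aStubsB1aB1bB3Holds.stubB1a_holds` (★ `Theorems/F0P2aStubsB1aB1bB3Holds`; ⇐ F0P3-p01's ★ `CuspCot.towerFamily_glue`,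
  `Theorems/F0P3TowerGlueClassMap`, landed 2026-08-30T22:14Z after this line was cut);
* `stub_B1b_regimeFormsTransportBack := F0P2aStubsB1aB1bB3Holds.stubB1b_holds` (⇐ A-p17's ★ `CuspCot.cuspCotSat_le_map_toRegimeFun`, `Theorems/H413HolCotFormsOfModel`);
* `stub_B3_towerHodgeSpanning := F0P2aStubsB1aB1bB3Holds.stubB3_holds` (⇐ A-p19's ★ `TowerConj.exists_H10T_add_conjT`, `Theorems/H413TowerHodgeDecomposition`);
* `stub_B4_cohIsoOfParts := P4aStubM3CohClassMapWithFormulas.stubB4_holds` (★ `Theorems/P4aStubM3CohClassMapWithFormulas`, A-p12 (g12): A-p08's ★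
  `exists_cohClassMap_of_hol` re-run with the decomposition identity exported + surjectivity; the same file closes P4a's `stub_M3_cohClassMapWithFormulas`).
Hence every head of §4–§5 (`range_clsHol_eq_H10T_of`, `exists_cohClassIso_tower_of`, `exists_cohClassIso_pin_of`, `exists_dec_pin_of`, `stubT2_of`, `stubS1_of`,
`stubU1_of`, `H413_of_F0P2a`) is now UNCONDITIONAL in the B-stubs: the desk theorem «`cohForms 𝔞₀(V) ≅ H¹_{B,τ'}(A_∞, ℂ)` equivariantly, extending `clsHol`»
is ASSEMBLED in the tree along this line (a second, independent assembly is F0P3-p01's ★ `CuspCot.exists_cohClassMap_bijective` ∕ `t2Bijective_pin`,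
`Theorems/F0P3CohFormsTowerIso`, and a third the P4a residual line `Lines/F0_P4aMatsushimaHodge.lean` once its `stub_M3` is folded).  Two imports added (the two
★ closer modules); nothing else changed.  HC_CM is proved only modulo the 7 printed citations until rung 0 closes.

## References
* [BorelWallach2000] A. Borel, N. Wallach, *Continuous cohomology, discrete subgroups, and representations of reductive groups*, 2nd ed., AMS 2000:
  VII 2.10 (Hodge bigrading of `(𝔤,K)`-cohomology by `𝔭^±`), VII 3.2 (Matsushima's formula), VII 3.6, XIII 1.2 (adelic pieces `colim_K`).
* [VoisinHodgeI2002] C. Voisin, *Hodge Theory and Complex Algebraic Geometry I*, CUP 2002: Prop. 6.11, Thm. 6.32 ∕ Cor. 7.6 (`H¹ = H^{1,0} ⊕ H^{0,1}`,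
  `H^{1,0} = H⁰(Ω¹)`), §7.1 (real structure, `F^p ⊕ conj F^{n+1-p}`).
* [DeligneHodgeII1971] P. Deligne, *Théorie de Hodge II*, Publ. IHÉS 40 (1971): 1.2.5 (opposed filtrations), 2.1.4 (the real structure `conj ⊗ id`).
* [Borel1997] A. Borel, *Automorphic forms on SL₂(ℝ)*, CUP 1997, §5.14 (automorphy factor ↔ functions on the group).
* [BorelJacquet1979] A. Borel, H. Jacquet, Corvallis PSPM 33.1, §4.1–§4.2 (smooth `K`-finite functions on `G(𝔸)`).
* [MatsushimaMurakami1963] Y. Matsushima, S. Murakami, Ann. of Math. 78 (1963), §4.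
* [Liu2021] Y. Liu, arXiv:2102.11518, proof of Prop. 4.13 (FJcycle.tex l. 2121–2146).
* Tree: ★ `Theorems/H413CuspCotClassMap` (`clsHol`, `clsHol_injective`, `clsHol_rightRep`, `clsHol_eq_clsAt`), ★ `Theorems/H413CuspCotPin`
  (`clsHol_mem_hodge10Part`, `exists_holClassMap_pin`, `t2a_holClassMapAt`), ★ `Theorems/H413CuspCotTower` (`towerFamily`, `towerFamily_mem`, `clsAt`,
  `clsAt_apply`), ★ `Theorems/H413CuspCotTransport` (`toRegimeFun`, `toRegimeFun_mem_cuspCotSat`), ★ `Theorems/H413CuspCotComponents` (`cuspCotSat`,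
  `comp`, `compClass`), ★ `Theorems/H413CohFormsCarriers(Lemmas)` (carriers; `IsHonest.rightRep_mem_cohForms`), ★ `Theorems/P4StubT1ArchFactor`
  (`archFactorOf_isHonest`), ★ `Theorems/H413CohFormsHodgeTypesDisjoint` (`disjoint_holCotForms_map_conjFun`), ★ `Theorems/H413TowerConj` (A-p19: `conjT`, `conjL`,
  `H10T`, `H10L`, `conjT_act`, `conjT_conjT`, `eq_zero_of_mem_H10T_of_conjT_eq`, `trPull_mem_F`, `conj_trPull`), ★ `Theorems/P4StubT2cCohClassMapOfHol` (A-p08: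
  `exists_cohClassMap_of_hol`), HodgeCM `Model/TowerCarrier`
  (`Tower`, `ofLevel`, `act`, `towerRep`), `Model/TowerAlgebra` (`of_smul_eq_act`), `Model/TowerLevel_1` (`towerLevel`, `W`, `trPull`),
  `Literature/AlgebraicGeometry/Motives/HodgeStructure` (`HodgeStructure.conj`, `complexConj`, `isCompl_F_complexConj`),
  `Cruxes/H413/Lines/F0_P2CohSpectrumL2` (`RealisedIn`, `StubU1RealisationAt`, binder types; texts pasted), ★ `Theorems/HCCMUnconditionalH413OfFacts` (`Hyp413Closing.H413_of_three_facts_flat`),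
  `Lines/F0_U3CohMultOne` (S1 text), `Lines/F0_P4AdmissibleOccursInH1` (T2 text).
-/

set_option autoImplicit false

-- the mandated namespace has the single-problem summit's repeated segment (`HodgeConjecture.HodgeConjecture`), as in every `Cruxes/…/Lines/*.lean` of this sub-problem
set_option linter.dupNamespace false

noncomputable section

namespace Summit.HodgeConjecture.HodgeConjecture.Cruxes.H413.F0P2aHodgeRealisation

open scoped TensorProduct
open MulAction NumberField NumberField.InfinitePlace IsDedekindDomain
open HodgeCM HodgeCM.Model HodgeCM.Model.LiuIndex HodgeCM.Model.TowerCarrier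
open Summit.HodgeConjecture.CorCM.Model
open Literature.AlgebraicGeometry.Motives (CMType AbelianVariety)
open Literature.NumberTheory.Automorphic.Liu2021.Def411WeilCarriers (lineOf locF Rep)
open Summit.HodgeConjecture.CorCM.Transposition.OmegaTransport (realUnit)
open HodgeCM.Model.ArchSideTerm (e₁)
open Literature.NumberTheory.GelbartRogawski1991.UnitaryDualPair
open Literature.RepresentationTheory Literature.RepresentationTheory.Liu2021
open Literature.AlgebraicGeometry.HodgeTheory Literature.NumberTheory.Automorphic.PicardCM
open Literature.AlgebraicGeometry.ShimuraVarieties Literature.AlgebraicGeometry.ShimuraVarieties.UnitaryCanonicalModel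
open Literature.NumberTheory.ComplexMultiplication
open Literature.NumberTheory.Automorphic
open Literature.NumberTheory.Automorphic.Liu2021 Literature.NumberTheory.Automorphic.Liu2021.AppendixC
open Literature.NumberTheory.GelbartRogawski1991
open Literature.NumberTheory.Transcendental (Arapura2012_Cor_15_4_6)
open Summit.HodgeConjecture.CorCM Summit.HodgeConjecture.CorCM.Transposition
open Summit.HodgeConjecture.CorCM.Lines.A3Liu413 (datum413)
open Summit.HodgeConjecture.HodgeConjecture.Cruxes.H413.CohFormsCarriers
open Summit.HodgeConjecture.HodgeConjecture.Cruxes.H413.CuspCot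
open Summit.HodgeConjecture.HodgeConjecture.Cruxes.H413.TowerConj (H10T H10L conjT conjL conjT_ofLevel conjL_apply conjT_act conjT_conjT
  mem_H10T_iff mem_H10L_iff eq_zero_of_mem_H10T_of_conjT_eq)

/-! ## §0  The floor's three binder types `HdictEType` ∕ `HJ3aType` ∕ `HoccType` (floor V7 ll. 72–85) and P2's `RealisedIn` ∕ `StubU1RealisationAt`, PASTED
TOKEN-IDENTICALLY from `Cruxes/H413/Lines/F0_P2CohSpectrumL2.lean` (F0P2-plan (g0), ll. 112–143, 165–166 + 198–203, 386–407) — by-import is blocked tonight by the farm snapshot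
(rc 75 `unbuilt:…F0_P2CohSpectrumL2`; see the import comment); U3-S1 from `Lines/F0_U3CohMultOne.lean` :163–171 and P4-T2 from `Lines/F0_P4AdmissibleOccursInH1.lean` :155–165,
also token-identical.  Same texts, same opens ⟹ the same terms: the consumers discharge their stubs from this file's heads by `exact`. -/

set_option synthInstance.maxHeartbeats 400000 in
set_option maxHeartbeats 8000000 in
/-- **TARGET TYPE `HdictEType`** = the TYPE of the `hdictE` binder of ★ p756419 `hc_cm_of_generic_floor_v7` (`Theorems/HCCMUnconditionalOfGenericFloorV7.lean` ll. 72–75)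
BYTE-FOR-BYTE = the statement of the registered stub `stub_oscillatorTriple_dictionaryExistence` (`Cruxes/H413/Lines/a3_liu413.lean` v10.2 :271–276): row III-2 (a)′, the
∀-face closure of `GelbartRogawski1991.oscillatorTriple_dictionaryExistence` at the printed datum. (print: Liu2021, proof of Prop. 4.13, l. 2145 (first sentence); Rem. 4.14)
(print: GelbartRogawski1991, Introduction p. 448 L30–33; Thm 5.1.1 p. 465) -/
def HdictEType : Prop :=
      ∀ (hDel : Literature.AlgebraicGeometry.ShimuraVarieties.UnitaryCanonicalModel.canonicalModel_exists_printed)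
        (F : HodgeCM.CMField) [IsGalois ℚ F] (h6 : 6 ≤ Module.finrank ℚ F) {ι₁ : F →+* ℂ} (V : HodgeCM.HermSpace3 F ι₁) (a₀ : RealScalar F)
        (Φ : CMType F) (hΦ : ι₁ ∈ Φ.1) (i : (I V (repAt a₀) (muLiu ι₁ GramClass.rep))),
        oscillatorTriple_dictionaryExistence (((uniformOmegaRep (Summit.HodgeConjecture.CorCM.DelRec.exists_recordSystem_of_printed hDel) ⟨HodgeCM.CMField.K F⟩ ι₁ ⟨HodgeCM.HermSpace3.Hm V, HodgeCM.HermSpace3.isHermitian V, HodgeCM.HermSpace3.signature_ι₁ V, HodgeCM.HermSpace3.posDef_of_ne V⟩ Φ e₁ (frameD V) (frameD_real V) (frameD_ne V) (ιVE V) (2 * imagUnit (HodgeCM.CMField.K F))⁻¹ (fun _ _ => (Rep.update ↥(maximalRealSubfield (HodgeCM.CMField.K F)) (imagUnitSq (HodgeCM.CMField.K F)) (Rep.ofLineOf ↥(maximalRealSubfield (HodgeCM.CMField.K F)) (imagUnitSq (HodgeCM.CMField.K F))) (locF ↥(maximalRealSubfield (HodgeCM.CMField.K F)) (imagUnitSq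 (HodgeCM.CMField.K F)) (realUnit ⟨HodgeCM.CMField.K F⟩ (repAt a₀ (Sigma.fst i)).1 (repAt a₀ (Sigma.fst i)).2.1 (repAt a₀ (Sigma.fst i)).2.2)) (realUnit ⟨HodgeCM.CMField.K F⟩ (repAt a₀ (Sigma.fst i)).1 (repAt a₀ (Sigma.fst i)).2.1 (repAt a₀ (Sigma.fst i)).2.2) rfl)))).prop413Data ((liuDictionaryPin exists_isReal_hodgeModel_holds hodgePQ_independent_of_hodgeModel_holds BallQuotient.ballQuotientUniformised_holds (cmAbelianVarietyRealised_of_eigenbasis exists_isReal_hodgeModel_holds hodgePQ_independent_of_hodgeModel_holds cmAbelianVarietyEigenbasisRealised_holds) Literature.NumberTheory.Transcendental.arapura2012_cor_15_4_6_holds V (I V (repAt a₀) (muLiu ι₁ GramClass.rep)) (line V (repAt a₀) (muLiu ι₁ GramClass.rep)))).H)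

set_option synthInstance.maxHeartbeats 400000 in
set_option maxHeartbeats 8000000 in
/-- The `hJ3a` binder type of floor V7 (ll. 77–80) BYTE-FOR-BYTE — programme P3's target (row III-J3a), a HYPOTHESIS of head 3 only. (print: Rogawski1990, Thm. 13.3.1)
(print: Liu2021, proof of Prop. 4.13, ll. 2131–2145) -/
def HJ3aType : Prop :=
      ∀ (hDel : Literature.AlgebraicGeometry.ShimuraVarieties.UnitaryCanonicalModel.canonicalModel_exists_printed)
        (F : HodgeCM.CMField) [IsGalois ℚ F] (h6 : 6 ≤ Module.finrank ℚ F) {ι₁ : F →+* ℂ} (V : HodgeCM.HermSpace3 F ι₁) (a₀ : RealScalar F)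
        (Φ : CMType F) (hΦ : ι₁ ∈ Φ.1) (i : (I V (repAt a₀) (muLiu ι₁ GramClass.rep))),
        (((uniformOmegaRep (Summit.HodgeConjecture.CorCM.DelRec.exists_recordSystem_of_printed hDel) ⟨HodgeCM.CMField.K F⟩ ι₁ ⟨HodgeCM.HermSpace3.Hm V, HodgeCM.HermSpace3.isHermitian V, HodgeCM.HermSpace3.signature_ι₁ V, HodgeCM.HermSpace3.posDef_of_ne V⟩ Φ e₁ (frameD V) (frameD_real V) (frameD_ne V) (ιVE V) (2 * imagUnit (HodgeCM.CMField.K F))⁻¹ (fun _ _ => (Rep.update ↥(maximalRealSubfield (HodgeCM.CMField.K F)) (imagUnitSq (HodgeCM.CMField.K F)) (Rep.ofLineOf ↥(maximalRealSubfield (HodgeCM.CMField.K F)) (imagUnitSq (HodgeCM.CMField.K F))) (locF ↥(maximalRealSubfield (HodgeCM.CMField.K F)) (imagUnitSq (HodgeCM.CMField.K F)) (realUnit ⟨HodgeCM.CMField.K F⟩ (repAt a₀ (Sigma.fst i)).1 (repAt a₀ (Sigma.fst i)).2.1 (repAt a₀ (Sigma.fst i)).2.2)) (realUnit ⟨HodgeCM.CMField.K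 F⟩ (repAt a₀ (Sigma.fst i)).1 (repAt a₀ (Sigma.fst i)).2.1 (repAt a₀ (Sigma.fst i)).2.2) rfl)))).prop413Data ((liuDictionaryPin exists_isReal_hodgeModel_holds hodgePQ_independent_of_hodgeModel_holds BallQuotient.ballQuotientUniformised_holds (cmAbelianVarietyRealised_of_eigenbasis exists_isReal_hodgeModel_holds hodgePQ_independent_of_hodgeModel_holds cmAbelianVarietyEigenbasisRealised_holds) Literature.NumberTheory.Transcendental.arapura2012_cor_15_4_6_holds V (I V (repAt a₀) (muLiu ι₁ GramClass.rep)) (line V (repAt a₀) (muLiu ι₁ GramClass.rep)))).H).multiplicity_le_one_printed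

set_option synthInstance.maxHeartbeats 400000 in
set_option maxHeartbeats 8000000 in
/-- The `hocc` binder type of floor V7 (ll. 82–85) BYTE-FOR-BYTE — programme P4's target (row III-2 (c)′), a HYPOTHESIS of head 3 only.
(print: Liu2021, proof of Prop. 4.13, l. 2145 («Conversely …»)) (print: GelbartRogawski1991, Thm 5.1.1 p. 465) (print: Li1992, Thm. 2.1) -/
def HoccType : Prop :=
      ∀ (hDel : Literature.AlgebraicGeometry.ShimuraVarieties.UnitaryCanonicalModel.canonicalModel_exists_printed)
        (F : HodgeCM.CMField) [IsGalois ℚ F] (h6 : 6 ≤ Module.finrank ℚ F) {ι₁ : F →+* ℂ} (V : HodgeCM.HermSpace3 F ι₁) (a₀ : RealScalar F)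
        (Φ : CMType F) (hΦ : ι₁ ∈ Φ.1) (i : (I V (repAt a₀) (muLiu ι₁ GramClass.rep))),
        admissible_occursInH1 (((uniformOmegaRep (Summit.HodgeConjecture.CorCM.DelRec.exists_recordSystem_of_printed hDel) ⟨HodgeCM.CMField.K F⟩ ι₁ ⟨HodgeCM.HermSpace3.Hm V, HodgeCM.HermSpace3.isHermitian V, HodgeCM.HermSpace3.signature_ι₁ V, HodgeCM.HermSpace3.posDef_of_ne V⟩ Φ e₁ (frameD V) (frameD_real V) (frameD_ne V) (ιVE V) (2 * imagUnit (HodgeCM.CMField.K F))⁻¹ (fun _ _ => (Rep.update ↥(maximalRealSubfield (HodgeCM.CMField.K F)) (imagUnitSq (HodgeCM.CMField.K F)) (Rep.ofLineOf ↥(maximalRealSubfield (HodgeCM.CMField.K F)) (imagUnitSq (HodgeCM.CMField.K F))) (locF ↥(maximalRealSubfield (HodgeCM.CMField.K F)) (imagUnitSq (HodgeCM.CMField.K F)) (realUnit ⟨HodgeCM.CMField.K F⟩ (repAt a₀ (Sigma.fst i)).1 (repAt a₀ (Sigma.fst i)).2.1 (repAt a₀ (Sigma.fst i)).2.2)) (realUnit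 ⟨HodgeCM.CMField.K F⟩ (repAt a₀ (Sigma.fst i)).1 (repAt a₀ (Sigma.fst i)).2.1 (repAt a₀ (Sigma.fst i)).2.2) rfl)))).prop413Data ((liuDictionaryPin exists_isReal_hodgeModel_holds hodgePQ_independent_of_hodgeModel_holds BallQuotient.ballQuotientUniformised_holds (cmAbelianVarietyRealised_of_eigenbasis exists_isReal_hodgeModel_holds hodgePQ_independent_of_hodgeModel_holds cmAbelianVarietyEigenbasisRealised_holds) Literature.NumberTheory.Transcendental.arapura2012_cor_15_4_6_holds V (I V (repAt a₀) (muLiu ι₁ GramClass.rep)) (line V (repAt a₀) (muLiu ι₁ GramClass.rep)))).H)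


section Generic

variable {F₀ E₀ : Type} [Field F₀] [NumberField F₀] [IsTotallyReal F₀] [Field E₀] [NumberField E₀] [Algebra F₀ E₀]
  [IsTotallyComplex E₀] [Algebra.IsQuadraticExtension F₀ E₀]

/-- **Shape of stub U1 — REALISATION of `H¹_{B,τ'}(A_∞, ℂ)` in the function space** (Matsushima–Hodge, the inverse of a class map): an INJECTIVE `P.G`-equivariant `ℂ`-linear
map `r : H¹_{B,τ'} → X` with values in `A`.  With P4's injective equivariant class map `A → H¹_{B,τ'}` this says `A ≅ H¹_{B,τ'}` ([BorelWallach2000, VII 3.2 ∕ 3.6] with Hodge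
theory). (print: BorelWallach2000, VII 2.10, 3.2, 3.6; XIII 1.2) (print: VoisinHodgeI2002, Prop. 6.11 and Cor. 7.6) -/
def RealisedIn (P : Prop413Data F₀ E₀) (τ' : E₀ →+* ℂ) {X : Type} [AddCommGroup X] [Module ℂ X] (R : Representation ℂ P.G X)
    (A : Submodule ℂ X) : Prop :=
  ∃ r : P.HB τ' →ₗ[ℂ] X, Function.Injective r ∧ (∀ x, r x ∈ A) ∧ ∀ (g : P.G) (x : P.HB τ'), r (P.rhoB τ' g x) = R g (r x)

end Generic

set_option synthInstance.maxHeartbeats 400000 in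
set_option maxHeartbeats 8000000 in
/-- STUB TYPE **U1′ — MATSUSHIMA–HODGE REALISATION AT THE PIN, AT THE FACTOR OF RECORD** (M–L; the inverse direction of P4's T2′): for every face, at `n = 3`, and every `τ'`:
`RealisedIn (datum413 …) τ' (rightRep F V) (cohForms (archFactorOf F V))` — an INJECTIVE `U(V)(𝔸_{F⁺,f})`-equivariant `ℂ`-linear map from the pin's `H¹_{B,τ'}(A_∞, ℂ)` into the
`ℂ²`-valued functions on `U(V)(𝔸_{F⁺})`, valued in the `(1,0) ⊕ (0,1)` cotangent automorphic forms for THE archimedean factor `𝔞₀(V) = archFactorOf F V` (CM archimedean section through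
`V.sylvesterFrame`; its honesty is P4's ★-to-be `Theorems/P4StubT1ArchFactor.lean` and is NOT consumed by this line's composition — A-plan1 (g17) 19:41:49Z GO (a)).  Content: at each level
`Γ`, every class in `H¹(P_Γ(V); ℂ)` of the compact Kähler surface `P_Γ = Γ\𝔹²` has a UNIQUE harmonic representative, which is a holomorphic `1`-form plus the conjugate of one ([VoisinHodgeI2002,
§6.1.3 Prop. 6.11, Cor. 7.6, §7.2.2]: `H¹ = H^{1,0} ⊕ H^{0,1}`, `H^{1,0} = H⁰(Ω¹)`); a holomorphic `1`-form of level `Γ.K` IS a holomorphic cotangent-weight automorphic form ([Borel1997, §5.14];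
[BorelWallach2000, VII 2.10, 3.6]; the levelwise dictionary with INJECTIVE `pull` is ★ `HodgeCM.Model.classMapDatumOf` ∕ `classMapDatumOf_pull_injective`, `H10 = F¹H¹(X_Γ)`); uniqueness makes
the representatives compatible with pull-back and Hecke translation (Matsushima–Murakami ∕ [BorelWallach2000, XIII 1.2]), so they assemble to an injective equivariant map out of `H = colim_K H¹`,
read in the `adelicGroupData` currency through the transport lemmas `toLatticeModelG_archFactorOf_ιinf` ∕ `toLatticeModelG_finToAdelic` of the carriers.  Why it might fail: as P4-T2′
(the pin's `H` is the tower of the identity components; the realisation lands in forms supported accordingly — reshaping, not failure).  SIZE M–L; desk shared with P4-T2′ (together: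
`cohForms 𝔞₀(V) ≅ H¹_{B,τ'}`). (print: BorelWallach2000, VII 2.10, 3.2, 3.6; XIII 1.2) (print: VoisinHodgeI2002, Prop. 6.11, Cor. 7.6) (print: Borel1997, §5.14) (print: MatsushimaMurakami1963, §4) -/
def StubU1RealisationAt : Prop :=
      ∀ (hDel : Literature.AlgebraicGeometry.ShimuraVarieties.UnitaryCanonicalModel.canonicalModel_exists_printed)
        (F : HodgeCM.CMField) [IsGalois ℚ F] (h6 : 6 ≤ Module.finrank ℚ F) {ι₁ : F →+* ℂ} (V : HodgeCM.HermSpace3 F ι₁) (a₀ : RealScalar F)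
        (Φ : CMType F) (hΦ : ι₁ ∈ Φ.1) (i : (I V (repAt a₀) (muLiu ι₁ GramClass.rep))),
      (datum413 hDel F V a₀ Φ i).n = 3 →
        ∀ τ' : HodgeCM.CMField.K F →+* ℂ, RealisedIn (datum413 hDel F V a₀ Φ i) τ' (rightRep F V) (cohForms (archFactorOf F V))

set_option synthInstance.maxHeartbeats 400000 in
set_option maxHeartbeats 8000000 in
/-- CONSUMER TYPE **U3-S1** `StubS1HodgeMatsushimaDecAt` — PASTED TOKEN-IDENTICALLY from `Cruxes/H413/Lines/F0_U3CohMultOne.lean` :163–171 (its registered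
`stub_S1_hodgeMatsushimaDecAt`): an injective `U(V)(𝔸_{F⁺,f})`-equivariant `dec : H¹_{B,τ'} → (U(V)(𝔸_{F⁺}) → ℂ²)` with values in `cohForms 𝔞₀`, `3 ≤ n`.
Closed here by `stubS1_of`. (print: BorelWallach2000, VII 3.2, VII 3.6, XIII 1.2) (print: VoisinHodgeI2002, Cor. 7.6) -/
def StubS1HodgeMatsushimaDecAt : Prop :=
  ∀ (hDel : Literature.AlgebraicGeometry.ShimuraVarieties.UnitaryCanonicalModel.canonicalModel_exists_printed)
      (F : HodgeCM.CMField) [IsGalois ℚ F] (h6 : 6 ≤ Module.finrank ℚ F) {ι₁ : F →+* ℂ} (V : HodgeCM.HermSpace3 F ι₁) (a₀ : RealScalar F)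
      (Φ : CMType F) (hΦ : ι₁ ∈ Φ.1) (i : (I V (repAt a₀) (muLiu ι₁ GramClass.rep))),
      3 ≤ (datum413 hDel F V a₀ Φ i).n → ∀ τ' : HodgeCM.CMField.K F →+* ℂ,
        ∃ dec : (datum413 hDel F V a₀ Φ i).HB τ' →ₗ[ℂ] ((adelicDatum F V).Adelic → (Fin 2 → ℂ)),
          Function.Injective dec ∧ (∀ x, dec x ∈ cohForms (archFactorOf F V)) ∧
            ∀ (g : ↥(HodgeCM.HermSpace3.adelicFin V)) (x : (datum413 hDel F V a₀ Φ i).HB τ'),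
              dec ((datum413 hDel F V a₀ Φ i).rhoB τ' g x) = rightRep F V g (dec x)

set_option synthInstance.maxHeartbeats 400000 in
set_option maxHeartbeats 8000000 in
/-- CONSUMER TYPE **P4-T2** `StubT2MatsushimaHodgeAt` — PASTED TOKEN-IDENTICALLY from `Cruxes/H413/Lines/F0_P4AdmissibleOccursInH1.lean` :155–165 (the node
P4's `stubT2_of` builds from T2a/T2b/T2c): an injective `U(V)(𝔸_{F⁺,f})`-equivariant class map `cls : cohForms 𝔞₀ → H¹_{B,τ'}`, `3 ≤ n`.  Closed here by `stubT2_of`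
(bijective ⟹ injective). (print: BorelWallach2000, VII 3.2, VII 3.6, XIII 1.2) (print: VoisinHodgeI2002, Cor. 7.6) -/
def StubT2MatsushimaHodgeAt : Prop :=
  ∀ (hDel : Literature.AlgebraicGeometry.ShimuraVarieties.UnitaryCanonicalModel.canonicalModel_exists_printed)
      (F : HodgeCM.CMField) [IsGalois ℚ F] (h6 : 6 ≤ Module.finrank ℚ F) {ι₁ : F →+* ℂ} (V : HodgeCM.HermSpace3 F ι₁) (a₀ : RealScalar F)
      (Φ : CMType F) (hΦ : ι₁ ∈ Φ.1) (i : (I V (repAt a₀) (muLiu ι₁ GramClass.rep))),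
      3 ≤ (datum413 hDel F V a₀ Φ i).n → ∀ τ' : HodgeCM.CMField.K F →+* ℂ,
        ∃ cls : ↥(cohForms (archFactorOf F V)) →ₗ[ℂ] (datum413 hDel F V a₀ Φ i).HB τ',
          Function.Injective cls ∧
            ∀ (g : ↥(HodgeCM.HermSpace3.adelicFin V)) (f : ↥(cohForms (archFactorOf F V)))
              (hgf : rightRep F V g (f : _) ∈ cohForms (archFactorOf F V)),
              cls ⟨rightRep F V g (f : _), hgf⟩ = (datum413 hDel F V a₀ Φ i).rhoB τ' g (cls f)

/-! ## §1  The `(1,0)`-part of the tower and its conjugation are IN THE TREE (A-p19 (g15), ★ p791712 `Theorems/H413TowerConj.lean`, landed 2026-08-30T21:51Z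
while this line was being cut): `TowerConj.H10T hHD hI hU h₃ hA V = ⨆ j, (H10L j).map (ofLevel j)` (P4-T2a's inline term = the third clause of ★ `CuspCot.clsHol_mem_hodge10Part`,
definitionally), `TowerConj.conjT … V : Tower →ₛₗ[starRingEnd ℂ] Tower` with `conjT_ofLevel`/`conjL_apply` (levelwise `HodgeStructure.conj`), `conjT_act`, `conjT_conjT`, and the
OPPOSEDNESS `eq_zero_of_mem_H10T_of_conjT_eq` (`H10T ∩ conjT H10T = 0`).  They are used BY NAME below — no stub of this line restates them (P4-T2b∕T2c are closed:
★ p791878 `Theorems/H413TowerConjPin`, ★ p791720 `Theorems/P4StubT2cCohClassMapOfHol`). -/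

/-! ## §2  The FOUR stub TYPES of this line (+ the type of the in-file lemma L5) -/

/-- STUB TYPE **B1a — LEVELWISE MATSUSHIMA SURJECTIVITY ON THE REGIME MODEL** (M; A-p13's currency `Theorems/H413CuspCotTower`): for every `(F, V)` in the
anisotropic regime, every universe record, every PKG level `Γ` below a conjugate of `K_f(3)` and every level family `c ∈ towerLevel Γ` ALL of whose components are
`(1,0)`-classes (`c h ∈ F¹H¹(P_{Γ_h}; ℂ)`), there is a saturated cuspidal cotangent form `F ∈ cuspCotSat V hV Γ.K` on the regime model whose cohomological
family ★ `towerFamily F` (`h ↦` the class of the component `u ↦ F(archInfOf u · (1,h))`) IS `c`.  Content: `F¹H¹(P_{Γ_h}) = H10` of the level class-map datum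
(★ `classMapDatumOf_H10`), whose `pull : H10 → holWeightForms (Γ_h)` (★ `classMapDatumOf`, total and injective on `H10`) gives the holomorphic cotangent-weight
form `φ_h` of the class `c h` on the ball ([VoisinHodgeI2002, Cor. 7.6]: `H^{1,0} = H⁰(Ω¹)`; [Borel1997, §5.14]); the family condition `c h = t_γ^* c h'` along
`h' ∈ γ_f h K` (★ `mem_towerLevel_iff`) is exactly the compatibility making `F(γ (u, h k)) := φ_h(u)` a well-defined left-`U(V)(F⁺)`-invariant, right-`sat(K)`-invariant
function on `G = U(V)(F⁺)·(U(2,1) × U(V)(𝔸_f))` (strong approximation is NOT needed: define `F` coset by coset over the finite class set, ★ `exists_corrector_of_mem_levelImage`,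
`comp_levelImage_mul`), with holomorphic germs; then `compClass F h = c h` by ★ `exists_unique_pull_eq_comp`.  The inverse of A-p13's `comp`/`compClass`/`towerFamily_mem`.
Why it might fail: only if `towerLevel Γ`'s translation condition were WEAKER than the automorphy of the glued function (it is not: it quantifies over all
`γ ∈ U(V)(F⁺)` and all `k ∈ K`, ★ `mem_towerLevel_of_translate_of_invariant` is an iff in content); size M (one file, 250–400 lines).
(print: BorelWallach2000, VII 3.2; XIII 1.2) (print: VoisinHodgeI2002, Cor. 7.6) (print: Borel1997, §5.14) (print: MatsushimaMurakami1963, §4) -/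
def StubB1aLevelFamiliesOnto : Prop :=
  ∀ (F : HodgeCM.CMField) {ι₁ : F →+* ℂ} (V : HodgeCM.HermSpace3 F ι₁) (hV : IsAnisotropic F (HodgeCM.HermSpace3.Hm V))
      (hHD : exists_isReal_hodgeModel) (hI : hodgePQ_independent_of_hodgeModel) (h₁ : BallQuotientUniformised) (h₃ : CMAbelianVarietyRealised)
      (hA : Arapura2012_Cor_15_4_6) (Γ : Level V) (hΓ : Γ.BelowConjThree)
      (c : ↥(HodgeCM.Model.TowerLevel.towerLevel hHD hI (ballQuotientUniformisedDatum_of h₁) h₃ hA Γ hΓ)),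
      (∀ h : ↥(HodgeCM.HermSpace3.adelicFin V),
          (c : Π h : ↥(HodgeCM.HermSpace3.adelicFin V), HodgeCM.Model.TowerLevel.W hHD hI (ballQuotientUniformisedDatum_of h₁) h₃ Γ hΓ h) h ∈
            ((HodgeCM.Model.universeOf hHD hI (ballQuotientUniformisedDatum_of h₁) h₃).hodge
                ((HodgeCM.Model.universeOf hHD hI (ballQuotientUniformisedDatum_of h₁) h₃).pms F ι₁ V (Γ.conj h hΓ)) 1).F 1) →
        ∃ (G : (V.latticeModel printFact_unitaryCompact_holds).G → (Fin 2 → ℂ)) (hG : G ∈ cuspCotSat V hV Γ.K),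
          towerFamily hHD hI h₁ h₃ hΓ hG =
            (c : Π h : ↥(HodgeCM.HermSpace3.adelicFin V), HodgeCM.Model.TowerLevel.W hHD hI (ballQuotientUniformisedDatum_of h₁) h₃ Γ hΓ h)

/-- STUB TYPE **B1b — TRANSPORT BACK FROM THE REGIME MODEL** (S–M; the converse of ★ `CuspCot.toRegimeFun_mem_cuspCotSat`): every saturated cuspidal
cotangent form `G ∈ cuspCotSat V hV K` of an OPEN level `K` on the regime model group `(V.latticeModel _).G` is `toRegimeFun f = f ∘ e⁻¹` (★ `latticeEquiv`) of an
adelic `f ∈ holCotForms (archFactorOf F V)`.  Content: `f := G ∘ e`; (W) weight and left invariance transport through ★ `latticeEquiv_ιinf` ∕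
`latticeEquiv_symm_mem_range_toAdelic` (the rational points correspond); (K_c) right `K_c`-invariance because the saturation subgroup `satLevelRegimeOf V hV K`
CONTAINS the away-from-`ι₁` compact factor (definition of `satLevelRegimeOf`; ★ `exists_of_mem_satLevelRegimeOf` is the other inclusion); smoothness = fixed by the
open `K` (`smoothFun` is `⨆_{K open}` of the `K`-invariants; ★ `latticeEquiv_finToAdelic`); (H) holomorphic germs transport as in the ★ proof.  Why it might fail: only
if `satLevelRegimeOf V hV K` did NOT contain the full archimedean compact factor `K_c` of `archFactorOf F V` (then `f` is merely `K_c ∩ sat`-invariant) — check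
★ `archFactorOf_Kc` against the definition first (cheapest falsifier); size S–M (80–150 lines).  (print: BorelJacquet1979, §4.1–§4.2) (print: BorelWallach2000, XIII 1.2) -/
def StubB1bRegimeFormsTransportBack : Prop :=
  ∀ (F : HodgeCM.CMField) {ι₁ : F →+* ℂ} (V : HodgeCM.HermSpace3 F ι₁) (hV : IsAnisotropic F (HodgeCM.HermSpace3.Hm V))
      (K : Subgroup ↥(HodgeCM.HermSpace3.adelicFin V)), IsOpen (K : Set ↥(HodgeCM.HermSpace3.adelicFin V)) →
      ∀ G ∈ cuspCotSat V hV K, ∃ f ∈ holCotForms (archFactorOf F V), toRegimeFun F V hV f = G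

/-- STUB TYPE **B3 — THE TOWER IS SPANNED BY ITS `(1,0)`-PART AND THE CONJUGATE OF IT** (M⁻; the SPANNING half of the Hodge decomposition of
`H = colim_K ⊕_h H¹(P_{Γ_h}; ℂ)` in degree one — the opposedness half is ★ `TowerConj.eq_zero_of_mem_H10T_of_conjT_eq`): for every `(F, V)` and every universe record
`(hHD, hI, hU, h₃, hA)`, every `z ∈ Tower` is `x + conjT y` with `x, y ∈ H10T` (★ `TowerConj.H10T`, ★ `TowerConj.conjT`).  Content: `z = ofLevel Γ c` (★ `exists_ofLevel`); on each
`H¹(P_Δ; ℂ)` the REAL Hodge structure of weight `1` (★ `Universe.hodge _ 1`) has `F¹ ⊕ conj F¹ = H¹` (★ `HodgeStructure.isCompl_F_complexConj 1 1 rfl`; [DeligneHodgeII1971, 1.2.5];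
[VoisinHodgeI2002, §7.1, Cor. 7.6]), so componentwise `c h = a h + conj (b h)` with `a h, b h ∈ F¹`; the families `a`, `b` lie in `towerLevel Γ` because the transitions `trPull`
are base-changed morphisms of Hodge structures — they preserve `F¹` (★ `TowerConj.trPull_mem_F`) and commute with `conj` (★ `TowerConj.conj_trPull`) — and the decomposition is direct,
so projecting the identity `c h = t_γ^* c h'` (★ `mem_towerLevel_iff`) onto `F¹` ∕ `conj F¹` gives the identities for `a` and `b`; then `z = ofLevel Γ a + conjT (ofLevel Γ b)`
(★ `conjT_ofLevel`, `conjL_apply`), both in `H10T` (★ `mem_H10T_iff`, `mem_H10L_iff`).  Why it might fail: only if ★ `Universe.hodge` were not a PURE weight-one structure with the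
`isCompl` axiom at `p = q = 1` (it is: `HodgeStructure.isCompl_F_complexConj`) — i.e. it cannot, short of a Lean plumbing surprise in projecting `Submodule.pi` families; size M⁻ (120–200 lines).
(print: DeligneHodgeII1971, 1.2.5) (print: VoisinHodgeI2002, §7.1 and Cor. 7.6) (print: BorelWallach2000, VII 2.10) -/
def StubB3TowerHodgeSpanning : Prop :=
  ∀ (F : HodgeCM.CMField) {ι₁ : F →+* ℂ} (V : HodgeCM.HermSpace3 F ι₁)
      (hHD : exists_isReal_hodgeModel) (hI : hodgePQ_independent_of_hodgeModel) (hU : BallQuotientUniformisedDatum) (h₃ : CMAbelianVarietyRealised)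
      (hA : Arapura2012_Cor_15_4_6) (z : Tower hHD hI hU h₃ hA V),
      ∃ x ∈ H10T hHD hI hU h₃ hA V, ∃ y ∈ H10T hHD hI hU h₃ hA V, z = x + conjT hHD hI hU h₃ hA V y

/-- STUB TYPE **B4 — THE `(1,0) ⊕ (0,1)` CLASS MAP IS AN ISOMORPHISM, FROM ITS PARTS** (M⁻; GENERIC carrier algebra — no pin, no tower): for every CM face `(F, V)`,
every `ℂ[U(V)(𝔸_{F⁺,f})]`-module `(H, ρ)`, every `P ≤ H`, every INJECTIVE `ρ`-EQUIVARIANT `cls₁₀ : holCotForms 𝔞₀ → H` with `range cls₁₀ = P` and every INVOLUTIVE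
`ρ`-EQUIVARIANT CONJUGATE-LINEAR `cT : H → H` with `P ∩ cT P = 0` and `P + cT P = H`, there is a BIJECTIVE `ρ`-EQUIVARIANT `cls : cohForms 𝔞₀ → H` EXTENDING `cls₁₀`
(`cohForms 𝔞₀ = holCotForms 𝔞₀ ⊔ conjFun (holCotForms 𝔞₀)`, carriers).  Content: `cls (f + conjFun f') := cls₁₀ f + cT (cls₁₀ f')` (Mathlib `LinearPMap.sup` ∕ `Submodule.mem_sup`
with uniqueness), well defined by ★ `disjoint_holCotForms_map_conjFun` (`Theorems/H413CohFormsHodgeTypesDisjoint`: a function of cotangent `K_∞`-type AND of the conjugate type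
vanishes); injective by `P ∩ cT P = 0` and the two injectivities; surjective by `P + cT P = H` and `range cls₁₀ = P`; equivariant because `conjFun` commutes with `rightRep` (★
`conjFun_rightRep`, `rfl`) and `holCotForms 𝔞₀` is `rightRep`-stable (★ `IsHonest.rightRep_mem_holCotForms` with ★ `archFactorOf_isHonest`).  The INJECTIVE half with this
very construction is P4-T2c, LANDED (★ p791720 `Theorems/P4StubT2cCohClassMapOfHol.exists_cohClassMap_of_hol`, A-p08: `cls := LinearMap.ofIsCompl (isCompl_holCotForms_map_conjFun 𝔞₀) φ ψ`
with the formula as its local `key`); the prover EXPORTS that formula (`cls ⟨a + conjFun a₂, _⟩ = cls₁₀ a + cT (cls₁₀ a₂)`) as a lemma and adds surjectivity from `P + cT P = H`,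
`range cls₁₀ = P`, and the extension clause.  Why it might fail: it cannot (the construction is landed); size S–M (80–150 lines, mostly by name).
(print: BorelWallach2000, VII 2.10 and 3.6) (print: Borel1997, §5.14) (print: VoisinHodgeI2002, Cor. 7.6) -/
def StubB4CohIsoOfParts : Prop :=
  ∀ (F : HodgeCM.CMField) {ι₁ : F →+* ℂ} (V : HodgeCM.HermSpace3 F ι₁) (H : Type) [AddCommGroup H] [Module ℂ H]
      (ρ : Representation ℂ ↥(HodgeCM.HermSpace3.adelicFin V) H) (P : Submodule ℂ H)
      (cls₁₀ : ↥(holCotForms (archFactorOf F V)) →ₗ[ℂ] H),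
      Function.Injective cls₁₀ →
        (∀ (g : ↥(HodgeCM.HermSpace3.adelicFin V)) (f : ↥(holCotForms (archFactorOf F V)))
            (hgf : rightRep F V g (f : _) ∈ holCotForms (archFactorOf F V)),
            cls₁₀ ⟨rightRep F V g (f : _), hgf⟩ = ρ g (cls₁₀ f)) →
          LinearMap.range cls₁₀ = P →
            ∀ cT : H →ₛₗ[starRingEnd ℂ] H, (∀ x : H, cT (cT x) = x) →
              (∀ (g : ↥(HodgeCM.HermSpace3.adelicFin V)) (x : H), cT (ρ g x) = ρ g (cT x)) →
                (∀ x y : H, x ∈ P → y ∈ P → cT y = x → x = 0) →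
                  (∀ z : H, ∃ x ∈ P, ∃ y ∈ P, z = x + cT y) →
                    ∃ cls : ↥(cohForms (archFactorOf F V)) →ₗ[ℂ] H,
                      Function.Bijective cls ∧
                        (∀ (g : ↥(HodgeCM.HermSpace3.adelicFin V)) (f : ↥(cohForms (archFactorOf F V)))
                            (hgf : rightRep F V g (f : _) ∈ cohForms (archFactorOf F V)),
                            cls ⟨rightRep F V g (f : _), hgf⟩ = ρ g (cls f)) ∧
                        ∀ f : ↥(holCotForms (archFactorOf F V)), cls ⟨(f : _), Submodule.mem_sup_left f.2⟩ = cls₁₀ f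

/-- LEMMA TYPE **L5 — INVERTING THE ISOMORPHISM: THE REALISATION `dec = cls⁻¹`** (S; GENERIC; PROVED below, `decOfIso`, from the two ★ lemmas): for every CM face `(F, V)`, every `ℂ[U(V)(𝔸_{F⁺,f})]`-module `(H, ρ)` and
every BIJECTIVE `ρ`-EQUIVARIANT `cls : cohForms 𝔞₀ → H` (equivariance in the T2 shape), there is an INJECTIVE `ℂ`-linear `dec : H → (U(V)(𝔸_{F⁺}) → ℂ²)` with values in
`cohForms 𝔞₀` and `dec (ρ g x) = R_g (dec x)`.  Content: `dec := (cohForms 𝔞₀).subtype ∘ (LinearEquiv.ofBijective cls _).symm`; equivariance from the T2-shape identity read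
backwards, using that `cohForms 𝔞₀` is `rightRep`-stable (★ `ArchFactor.IsHonest.rightRep_mem_cohForms` with ★ `archFactorOf_isHonest`).  Not a stub (it would be a
bookkeeping stub): proved in §4 as `decOfIso`.
(print: BorelWallach2000, VII 3.2) (print: Liu2021, proof of Prop. 4.13, l. 2121–2131) -/
def DecOfIso : Prop :=
  ∀ (F : HodgeCM.CMField) {ι₁ : F →+* ℂ} (V : HodgeCM.HermSpace3 F ι₁) (H : Type) [AddCommGroup H] [Module ℂ H]
      (ρ : Representation ℂ ↥(HodgeCM.HermSpace3.adelicFin V) H) (cls : ↥(cohForms (archFactorOf F V)) →ₗ[ℂ] H),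
      Function.Bijective cls →
        (∀ (g : ↥(HodgeCM.HermSpace3.adelicFin V)) (f : ↥(cohForms (archFactorOf F V)))
            (hgf : rightRep F V g (f : _) ∈ cohForms (archFactorOf F V)),
            cls ⟨rightRep F V g (f : _), hgf⟩ = ρ g (cls f)) →
          ∃ dec : H →ₗ[ℂ] ((adelicDatum F V).Adelic → (Fin 2 → ℂ)),
            Function.Injective dec ∧ (∀ x, dec x ∈ cohForms (archFactorOf F V)) ∧
              ∀ (g : ↥(HodgeCM.HermSpace3.adelicFin V)) (x : H), dec (ρ g x) = rightRep F V g (dec x)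

/-! ## §3  The FOUR REGISTERED STUBS B1a, B1b, B3, B4 (ed. 1: the ONLY `sorry`s of this file; ED. 2: all four CLOSED BY NAME — no `sorry` left) -/

/-- STUB B1a (M). [cite: BorelWallach2000, VII 3.2; XIII 1.2] [cite: VoisinHodgeI2002, Cor. 7.6] -/
theorem stub_B1a_levelFamiliesOnto : StubB1aLevelFamiliesOnto :=
  Summit.HodgeConjecture.HodgeConjecture.Cruxes.H413.F0P2aStubsB1aB1bB3Holds.stubB1a_holds

/-- STUB B1b (S–M). [cite: BorelJacquet1979, §4.1–§4.2] -/
theorem stub_B1b_regimeFormsTransportBack : StubB1bRegimeFormsTransportBack :=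
  Summit.HodgeConjecture.HodgeConjecture.Cruxes.H413.F0P2aStubsB1aB1bB3Holds.stubB1b_holds

/-- STUB B3 (M⁻). [cite: DeligneHodgeII1971, 1.2.5] [cite: VoisinHodgeI2002, §7.1] -/
theorem stub_B3_towerHodgeSpanning : StubB3TowerHodgeSpanning :=
  Summit.HodgeConjecture.HodgeConjecture.Cruxes.H413.F0P2aStubsB1aB1bB3Holds.stubB3_holds

/-- STUB B4 (S–M). [cite: BorelWallach2000, VII 2.10 and 3.6] -/
theorem stub_B4_cohIsoOfParts : StubB4CohIsoOfParts :=
  Summit.HodgeConjecture.HodgeConjecture.Cruxes.H413.P4aStubM3CohClassMapWithFormulas.stubB4_holds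

/-! ## §4  KERNEL-CHECKED COMPOSITIONS (no `sorry` in their own terms) -/

/-- **B1a + B1b + ★ ⟹ the holomorphic class map is ONTO the `(1,0)`-part**: `LinearMap.range clsHol = H10T` (`≤` is ★ `clsHol_mem_hodge10Part` — P4-T2a's inline term IS
`H10T` definitionally; `≥`: a generator `ofLevel Γ c`, `c` a `(1,0)`-family (★ `mem_H10T_iff`, `mem_H10L_iff`), is `clsAt Γ G = clsHol f` for B1a's `G` and B1b's `f`, ★ `clsHol_eq_clsAt`,
★ `clsAt_apply`). [cite: BorelWallach2000, VII 3.2; XIII 1.2] [cite: VoisinHodgeI2002, Cor. 7.6] -/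
theorem range_clsHol_eq_H10T_of (b1a : StubB1aLevelFamiliesOnto) (b1b : StubB1bRegimeFormsTransportBack)
    (F : HodgeCM.CMField) {ι₁ : F →+* ℂ} (V : HodgeCM.HermSpace3 F ι₁) (hV : IsAnisotropic F (HodgeCM.HermSpace3.Hm V))
    (hHD : exists_isReal_hodgeModel) (hI : hodgePQ_independent_of_hodgeModel) (h₁ : BallQuotientUniformised) (h₃ : CMAbelianVarietyRealised)
    (hA : Arapura2012_Cor_15_4_6) :
    LinearMap.range (clsHol hHD hI h₁ h₃ hA hV) = H10T hHD hI (ballQuotientUniformisedDatum_of h₁) h₃ hA V := by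
  refine le_antisymm ?_ ?_
  · rintro x ⟨f, rfl⟩
    exact clsHol_mem_hodge10Part F V hV hHD hI h₁ h₃ hA f
  · intro x hx
    obtain ⟨j, c, hc, rfl⟩ := (mem_H10T_iff hHD hI (ballQuotientUniformisedDatum_of h₁) h₃ hA V x).1 hx
    have hc' := (mem_H10L_iff hHD hI (ballQuotientUniformisedDatum_of h₁) h₃ hA c).1 hc
    obtain ⟨G, hG, hfam⟩ := b1a F V hV hHD hI h₁ h₃ hA j.1 j.2 c hc'
    obtain ⟨f, hf, hfG⟩ := b1b F V hV j.1.K j.1.isOpen_K G hG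
    subst hfG
    refine LinearMap.mem_range.2 ⟨⟨f, hf⟩, ?_⟩
    rw [clsHol_eq_clsAt hHD hI h₁ h₃ hA hV ⟨f, hf⟩ j.2 hG, clsAt_apply]
    congr 1
    exact Subtype.ext hfam

/-- **THE DESK THEOREM ON THE TOWER, FROM THE STUBS** (`B1a → B1b → B3 → B4 → …`, any universe record over `ballQuotientUniformisedDatum_of h₁`, anisotropic
regime): a BIJECTIVE `ℂ`-linear `cls : cohForms (archFactorOf F V) → Tower … V` intertwining `rightRep F V` with `act`, extending ★ `clsHol`.  Assembly: B4 at `H = Tower`,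
`ρ = towerRep` (`= act`, `rfl`), `P = H10T`, `cls₁₀ = clsHol` (★ injective, ★ equivariant, range `= H10T` by B1a+B1b), `cT = conjT` (★ involutive, ★ commutes with `act`,
★ opposed to `H10T`), spanning by B3. [cite: BorelWallach2000, VII 3.2, VII 3.6; XIII 1.2] [cite: VoisinHodgeI2002, Cor. 7.6] [cite: DeligneHodgeII1971, 1.2.5, 2.1.4] -/
theorem exists_cohClassIso_tower_of (b1a : StubB1aLevelFamiliesOnto) (b1b : StubB1bRegimeFormsTransportBack) (b3 : StubB3TowerHodgeSpanning)
    (b4 : StubB4CohIsoOfParts)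
    (F : HodgeCM.CMField) {ι₁ : F →+* ℂ} (V : HodgeCM.HermSpace3 F ι₁) (hV : IsAnisotropic F (HodgeCM.HermSpace3.Hm V))
    (hHD : exists_isReal_hodgeModel) (hI : hodgePQ_independent_of_hodgeModel) (h₁ : BallQuotientUniformised) (h₃ : CMAbelianVarietyRealised)
    (hA : Arapura2012_Cor_15_4_6) :
    ∃ cls : ↥(cohForms (archFactorOf F V)) →ₗ[ℂ] Tower hHD hI (ballQuotientUniformisedDatum_of h₁) h₃ hA V,
      Function.Bijective cls ∧
        (∀ (g : ↥(HodgeCM.HermSpace3.adelicFin V)) (f : ↥(cohForms (archFactorOf F V)))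
            (hgf : rightRep F V g (f : _) ∈ cohForms (archFactorOf F V)),
            cls ⟨rightRep F V g (f : _), hgf⟩ = act hHD hI (ballQuotientUniformisedDatum_of h₁) h₃ hA g (cls f)) ∧
        ∀ f : ↥(holCotForms (archFactorOf F V)), cls ⟨(f : _), Submodule.mem_sup_left f.2⟩ = clsHol hHD hI h₁ h₃ hA hV f := by
  -- B1a + B1b: the holomorphic class map is onto the `(1,0)`-part
  have hrange := range_clsHol_eq_H10T_of b1a b1b F V hV hHD hI h₁ h₃ hA
  -- B4 at `ρ = towerRep` (`towerRep g = act g`, `rfl`), `cT = conjT` (★), spanning from B3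
  obtain ⟨cls, hbij, hequiv, hext⟩ := b4 F V (Tower hHD hI (ballQuotientUniformisedDatum_of h₁) h₃ hA V)
      (towerRep hHD hI (ballQuotientUniformisedDatum_of h₁) h₃ hA V) (H10T hHD hI (ballQuotientUniformisedDatum_of h₁) h₃ hA V)
      (clsHol hHD hI h₁ h₃ hA hV) (clsHol_injective _ _ _ _ _ hV)
      (fun g f hgf => by
        rw [towerRep_apply]
        exact clsHol_rightRep hHD hI h₁ h₃ hA hV g f hgf)
      hrange (conjT hHD hI (ballQuotientUniformisedDatum_of h₁) h₃ hA V)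
      (conjT_conjT hHD hI (ballQuotientUniformisedDatum_of h₁) h₃ hA)
      (fun g x => by
        rw [towerRep_apply]
        exact conjT_act hHD hI (ballQuotientUniformisedDatum_of h₁) h₃ hA g x)
      (fun x y hx hy hyx => eq_zero_of_mem_H10T_of_conjT_eq hHD hI (ballQuotientUniformisedDatum_of h₁) h₃ hA hx hy hyx)
      (b3 F V hHD hI (ballQuotientUniformisedDatum_of h₁) h₃ hA)
  refine ⟨cls, hbij, fun g f hgf => ?_, hext⟩
  have e := hequiv g f hgf
  rw [towerRep_apply] at e
  exact e

/-- **L5 — `dec = cls⁻¹`** (generic): a bijective equivariant `cls : cohForms 𝔞₀ → H` inverts to an injective equivariant `dec : H → (U(V)(𝔸_{F⁺}) → ℂ²)` with values in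
`cohForms 𝔞₀`; `dec := (cohForms 𝔞₀).subtype ∘ cls⁻¹`, equivariance read backwards through ★ `ArchFactor.IsHonest.rightRep_mem_cohForms` (★ `archFactorOf_isHonest`).
[cite: BorelWallach2000, VII 3.2] [cite: Liu2021, proof of Prop. 4.13, l. 2121–2131] -/
theorem decOfIso : DecOfIso := by
  intro F ι₁ V H _ _ ρ cls hbij hequiv
  let e : ↥(cohForms (archFactorOf F V)) ≃ₗ[ℂ] H := LinearEquiv.ofBijective cls hbij
  refine ⟨(cohForms (archFactorOf F V)).subtype ∘ₗ (e.symm : H →ₗ[ℂ] ↥(cohForms (archFactorOf F V))), ?_, ?_, ?_⟩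
  · intro x y hxy
    exact e.symm.injective (Subtype.val_injective hxy)
  · intro x
    exact (e.symm x).2
  · intro g x
    obtain ⟨f, rfl⟩ := e.surjective x
    have hgf : rightRep F V g (f : _) ∈ cohForms (archFactorOf F V) :=
      (Summit.HodgeConjecture.HodgeConjecture.Cruxes.H413.P4StubT1ArchFactor.archFactorOf_isHonest F V).rightRep_mem_cohForms f.2 g
    have h1 : e ⟨rightRep F V g (f : _), hgf⟩ = ρ g (e f) := hequiv g f hgf
    change ((e.symm (ρ g (e f)) : ↥(cohForms (archFactorOf F V))) : (adelicDatum F V).Adelic → (Fin 2 → ℂ)) =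
      rightRep F V g ((e.symm (e f) : ↥(cohForms (archFactorOf F V))) : (adelicDatum F V).Adelic → (Fin 2 → ℂ))
    rw [← h1, e.symm_apply_apply, e.symm_apply_apply]

/-- **THE REALISATION ON THE TOWER, FROM THE STUBS** (+ L5 `decOfIso`): an INJECTIVE `ℂ`-linear `dec : Tower … V → (U(V)(𝔸_{F⁺}) → ℂ²)` with values in
`cohForms (archFactorOf F V)` intertwining `act` with `rightRep F V` (`dec = cls⁻¹`). [cite: BorelWallach2000, VII 3.2; XIII 1.2] [cite: VoisinHodgeI2002, Cor. 7.6] -/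
theorem exists_dec_tower_of (b1a : StubB1aLevelFamiliesOnto) (b1b : StubB1bRegimeFormsTransportBack)
    (b3 : StubB3TowerHodgeSpanning) (b4 : StubB4CohIsoOfParts)
    (F : HodgeCM.CMField) {ι₁ : F →+* ℂ} (V : HodgeCM.HermSpace3 F ι₁) (hV : IsAnisotropic F (HodgeCM.HermSpace3.Hm V))
    (hHD : exists_isReal_hodgeModel) (hI : hodgePQ_independent_of_hodgeModel) (h₁ : BallQuotientUniformised) (h₃ : CMAbelianVarietyRealised)
    (hA : Arapura2012_Cor_15_4_6) :
    ∃ dec : Tower hHD hI (ballQuotientUniformisedDatum_of h₁) h₃ hA V →ₗ[ℂ] ((adelicDatum F V).Adelic → (Fin 2 → ℂ)),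
      Function.Injective dec ∧ (∀ x, dec x ∈ cohForms (archFactorOf F V)) ∧
        ∀ (g : ↥(HodgeCM.HermSpace3.adelicFin V)) (x : Tower hHD hI (ballQuotientUniformisedDatum_of h₁) h₃ hA V),
          dec (act hHD hI (ballQuotientUniformisedDatum_of h₁) h₃ hA g x) = rightRep F V g (dec x) := by
  obtain ⟨cls, hbij, hequiv, -⟩ := exists_cohClassIso_tower_of b1a b1b b3 b4 F V hV hHD hI h₁ h₃ hA
  obtain ⟨dec, hinj, hmem, hdec⟩ := decOfIso F V (Tower hHD hI (ballQuotientUniformisedDatum_of h₁) h₃ hA V)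
      (towerRep hHD hI (ballQuotientUniformisedDatum_of h₁) h₃ hA V) cls hbij
      (fun g f hgf => by
        rw [towerRep_apply]
        exact hequiv g f hgf)
  refine ⟨dec, hinj, hmem, fun g x => ?_⟩
  have e := hdec g x
  rw [towerRep_apply] at e
  exact e

set_option synthInstance.maxHeartbeats 400000 in
set_option maxHeartbeats 8000000 in
/-- **THE DESK THEOREM AT THE PIN — `cohForms 𝔞₀(V) ≅ H¹_{B,τ'}(A_∞, ℂ)`, EQUIVARIANTLY**: for every face and every `τ'` there is a BIJECTIVE `ℂ`-linear
`cls : cohForms (archFactorOf F V) → (datum413 …).HB τ'` intertwining `rightRep F V` with the pin's `rhoB τ'`.  The pin's `HB τ'` IS `Tower … V` at the records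
of record and `rhoB τ' g = act g` (★ `ofModule'_apply_eq_of_smul`, ★ `of_smul_eq_act`), exactly as in ★ `CuspCot.exists_holClassMap_pin`; `IsAnisotropic` from `6 ≤ [F:ℚ]`.
[cite: BorelWallach2000, VII 3.2, VII 3.6; XIII 1.2] [cite: VoisinHodgeI2002, Cor. 7.6] [cite: Liu2021, proof of Prop. 4.13, l. 2145] -/
theorem exists_cohClassIso_pin_of (b1a : StubB1aLevelFamiliesOnto) (b1b : StubB1bRegimeFormsTransportBack)
    (b3 : StubB3TowerHodgeSpanning) (b4 : StubB4CohIsoOfParts)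
    (hDel : Literature.AlgebraicGeometry.ShimuraVarieties.UnitaryCanonicalModel.canonicalModel_exists_printed)
    (F : HodgeCM.CMField) [IsGalois ℚ F] (h6 : 6 ≤ Module.finrank ℚ F) {ι₁ : F →+* ℂ} (V : HodgeCM.HermSpace3 F ι₁) (a₀ : RealScalar F)
    (Φ : CMType F) (i : (I V (repAt a₀) (muLiu ι₁ GramClass.rep))) (τ' : HodgeCM.CMField.K F →+* ℂ) :
    ∃ cls : ↥(cohForms (archFactorOf F V)) →ₗ[ℂ] (datum413 hDel F V a₀ Φ i).HB τ',
      Function.Bijective cls ∧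
        ∀ (g : ↥(HodgeCM.HermSpace3.adelicFin V)) (f : ↥(cohForms (archFactorOf F V)))
          (hgf : rightRep F V g (f : _) ∈ cohForms (archFactorOf F V)),
          cls ⟨rightRep F V g (f : _), hgf⟩ = (datum413 hDel F V a₀ Φ i).rhoB τ' g (cls f) := by
  have h4 : 4 ≤ Module.finrank ℚ F := le_trans (by norm_num) h6
  have hV : IsAnisotropic F (HodgeCM.HermSpace3.Hm V) := HodgeCM.HermSpace3.isAnisotropic V h4
  obtain ⟨cls, hbij, hequiv, -⟩ := exists_cohClassIso_tower_of b1a b1b b3 b4 F V hV exists_isReal_hodgeModel_holds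
      hodgePQ_independent_of_hodgeModel_holds Summit.HodgeConjecture.CorCM.BallQuotient.ballQuotientUniformised_holds
      (cmAbelianVarietyRealised_of_eigenbasis exists_isReal_hodgeModel_holds hodgePQ_independent_of_hodgeModel_holds
        Summit.HodgeConjecture.CorCM.cmAbelianVarietyEigenbasisRealised_holds)
      Literature.NumberTheory.Transcendental.arapura2012_cor_15_4_6_holds
  refine ⟨cls, hbij, fun g f hgf => ?_⟩
  -- the pin's `rhoB τ' = Representation.ofModule'` acts on the tower by `of g • · = act g`
  have h2 := (Literature.RepresentationTheory.Semisimple.ofModule'_apply_eq_of_smul (k := ℂ) (G := ↥(HodgeCM.HermSpace3.adelicFin V)) _ g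
      (cls f)).trans (of_smul_eq_act _ _ _ _ _ g _)
  exact (hequiv g f hgf).trans h2.symm

set_option synthInstance.maxHeartbeats 400000 in
set_option maxHeartbeats 8000000 in
/-- **THE REALISATION AT THE PIN** (S1∕U1′ shape): an INJECTIVE equivariant `dec : (datum413 …).HB τ' → (U(V)(𝔸_{F⁺}) → ℂ²)` with values in `cohForms 𝔞₀`.
[cite: BorelWallach2000, VII 3.2, VII 3.6; XIII 1.2] [cite: VoisinHodgeI2002, Cor. 7.6] -/
theorem exists_dec_pin_of (b1a : StubB1aLevelFamiliesOnto) (b1b : StubB1bRegimeFormsTransportBack)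
    (b3 : StubB3TowerHodgeSpanning) (b4 : StubB4CohIsoOfParts)
    (hDel : Literature.AlgebraicGeometry.ShimuraVarieties.UnitaryCanonicalModel.canonicalModel_exists_printed)
    (F : HodgeCM.CMField) [IsGalois ℚ F] (h6 : 6 ≤ Module.finrank ℚ F) {ι₁ : F →+* ℂ} (V : HodgeCM.HermSpace3 F ι₁) (a₀ : RealScalar F)
    (Φ : CMType F) (i : (I V (repAt a₀) (muLiu ι₁ GramClass.rep))) (τ' : HodgeCM.CMField.K F →+* ℂ) :
    ∃ dec : (datum413 hDel F V a₀ Φ i).HB τ' →ₗ[ℂ] ((adelicDatum F V).Adelic → (Fin 2 → ℂ)),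
      Function.Injective dec ∧ (∀ x, dec x ∈ cohForms (archFactorOf F V)) ∧
        ∀ (g : ↥(HodgeCM.HermSpace3.adelicFin V)) (x : (datum413 hDel F V a₀ Φ i).HB τ'),
          dec ((datum413 hDel F V a₀ Φ i).rhoB τ' g x) = rightRep F V g (dec x) := by
  have h4 : 4 ≤ Module.finrank ℚ F := le_trans (by norm_num) h6
  have hV : IsAnisotropic F (HodgeCM.HermSpace3.Hm V) := HodgeCM.HermSpace3.isAnisotropic V h4
  obtain ⟨dec, hinj, hmem, hdec⟩ := exists_dec_tower_of b1a b1b b3 b4 F V hV exists_isReal_hodgeModel_holds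
      hodgePQ_independent_of_hodgeModel_holds Summit.HodgeConjecture.CorCM.BallQuotient.ballQuotientUniformised_holds
      (cmAbelianVarietyRealised_of_eigenbasis exists_isReal_hodgeModel_holds hodgePQ_independent_of_hodgeModel_holds
        Summit.HodgeConjecture.CorCM.cmAbelianVarietyEigenbasisRealised_holds)
      Literature.NumberTheory.Transcendental.arapura2012_cor_15_4_6_holds
  refine ⟨dec, hinj, hmem, fun g x => ?_⟩
  have h2 := (Literature.RepresentationTheory.Semisimple.ofModule'_apply_eq_of_smul (k := ℂ) (G := ↥(HodgeCM.HermSpace3.adelicFin V))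
      (Tower exists_isReal_hodgeModel_holds hodgePQ_independent_of_hodgeModel_holds
        (ballQuotientUniformisedDatum_of Summit.HodgeConjecture.CorCM.BallQuotient.ballQuotientUniformised_holds)
        (cmAbelianVarietyRealised_of_eigenbasis exists_isReal_hodgeModel_holds hodgePQ_independent_of_hodgeModel_holds
          Summit.HodgeConjecture.CorCM.cmAbelianVarietyEigenbasisRealised_holds)
        Literature.NumberTheory.Transcendental.arapura2012_cor_15_4_6_holds V) g x).trans
    (of_smul_eq_act _ _ _ _ _ g _)
  exact (congrArg dec h2).trans (hdec g x)

set_option synthInstance.maxHeartbeats 400000 in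
set_option maxHeartbeats 8000000 in
/-- **HEAD (P4) — `StubT2MatsushimaHodgeAt` from B1a, B1b, B3, B4** (bijective ⟹ injective). [cite: BorelWallach2000, VII 3.2, VII 3.6; XIII 1.2] [cite: VoisinHodgeI2002, Cor. 7.6] -/
theorem stubT2_of (b1a : StubB1aLevelFamiliesOnto) (b1b : StubB1bRegimeFormsTransportBack)
    (b3 : StubB3TowerHodgeSpanning) (b4 : StubB4CohIsoOfParts) : StubT2MatsushimaHodgeAt := by
  intro hDel F _ h6 ι₁ V a₀ Φ _ i _ τ'
  obtain ⟨cls, hbij, hequiv⟩ := exists_cohClassIso_pin_of b1a b1b b3 b4 hDel F h6 V a₀ Φ i τ'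
  exact ⟨cls, hbij.1, hequiv⟩

set_option synthInstance.maxHeartbeats 400000 in
set_option maxHeartbeats 8000000 in
/-- **HEAD (U3/P3) — `StubS1HodgeMatsushimaDecAt` from the four stubs** (`dec = cls⁻¹`, L5 `decOfIso`). [cite: BorelWallach2000, VII 3.2, VII 3.6; XIII 1.2] [cite: VoisinHodgeI2002, Cor. 7.6] -/
theorem stubS1_of (b1a : StubB1aLevelFamiliesOnto) (b1b : StubB1bRegimeFormsTransportBack)
    (b3 : StubB3TowerHodgeSpanning) (b4 : StubB4CohIsoOfParts) : StubS1HodgeMatsushimaDecAt := by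
  intro hDel F _ h6 ι₁ V a₀ Φ _ i _ τ'
  exact exists_dec_pin_of b1a b1b b3 b4 hDel F h6 V a₀ Φ i τ'

set_option synthInstance.maxHeartbeats 400000 in
set_option maxHeartbeats 8000000 in
/-- **HEAD (P2) — `StubU1RealisationAt` BY NAME from the four stubs** (`RealisedIn (datum413 …) τ' (rightRep F V) (cohForms (archFactorOf F V))`, at `n = 3`;
`RealisedIn` unfolds to the S1 shape). [cite: BorelWallach2000, VII 2.10, VII 3.2, VII 3.6; XIII 1.2] [cite: VoisinHodgeI2002, Prop. 6.11 and Cor. 7.6] -/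
theorem stubU1_of (b1a : StubB1aLevelFamiliesOnto) (b1b : StubB1bRegimeFormsTransportBack)
    (b3 : StubB3TowerHodgeSpanning) (b4 : StubB4CohIsoOfParts) : StubU1RealisationAt := by
  intro hDel F _ h6 ι₁ V a₀ Φ _ i _ τ'
  obtain ⟨dec, hinj, hmem, hequiv⟩ := exists_dec_pin_of b1a b1b b3 b4 hDel F h6 V a₀ Φ i τ'
  exact ⟨dec, hinj, hmem, hequiv⟩

set_option synthInstance.maxHeartbeats 400000 in
set_option maxHeartbeats 8000000 in
/-- **HEAD — THE CRUX DECL `HCCMUnconditional.H413` BY NAME** from this line's four stubs (the archimedean side = P2-U1′), the REST OF P2's SPLIT `hrest : U1′ → hdictE`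
(= P2's ★ `P2CohSpectrumL2.oscillatorTriple_dictionaryExistence_holds_of_split · U2ℓ U2a E2E2b U4`, `Cruxes/H413/Lines/F0_P2CohSpectrumL2.lean` :575 — taken as ONE binder only
because that module is unbuilt in tonight's farm snapshot, see the import comment; it is discharged BY NAME once the import resolves), P3's `hJ3a` and P4's `hocc`, via A-p07's ★
`Hyp413Closing.H413_of_three_facts_flat`.  This is the theorem the line audit of crux item stmt-HodgeConjecture-24833 reads.
[cite: Liu2021, Prop. 4.13 and proof l. 2121–2146; Rem. 4.14] [cite: GelbartRogawski1991, Introduction p. 448; Thm 5.1.1] [cite: Rogawski1990, Thm. 13.3.1] -/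
theorem H413_of_F0P2a (b1a : StubB1aLevelFamiliesOnto) (b1b : StubB1bRegimeFormsTransportBack)
    (b3 : StubB3TowerHodgeSpanning) (b4 : StubB4CohIsoOfParts)
    (hrest : StubU1RealisationAt → HdictEType) (hJ3a : HJ3aType) (hocc : HoccType) :
    Summit.HodgeConjecture.HodgeConjecture.Theses.HCCMUnconditional.H413 :=
  Summit.HodgeConjecture.CorCM.Hyp413Closing.H413_of_three_facts_flat (hrest (stubU1_of b1a b1b b3 b4)) hJ3a hocc

/-- **ZERO-HYPOTHESIS FOLD** (this file's registered stubs plugged in): P2-U1′ from this file's `sorry`s alone. [cite: BorelWallach2000, VII 3.2] -/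
theorem stubU1_realisationAt_F0P2a : StubU1RealisationAt :=
  stubU1_of stub_B1a_levelFamiliesOnto stub_B1b_regimeFormsTransportBack stub_B3_towerHodgeSpanning stub_B4_cohIsoOfParts

/-- Zero-hypothesis fold for U3-S1. [cite: BorelWallach2000, VII 3.2] -/
theorem stubS1_hodgeMatsushimaDecAt_F0P2a : StubS1HodgeMatsushimaDecAt :=
  stubS1_of stub_B1a_levelFamiliesOnto stub_B1b_regimeFormsTransportBack stub_B3_towerHodgeSpanning stub_B4_cohIsoOfParts

/-- Zero-hypothesis fold for P4-T2. [cite: BorelWallach2000, VII 3.2] -/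
theorem stubT2_matsushimaHodgeAt_F0P2a : StubT2MatsushimaHodgeAt :=
  stubT2_of stub_B1a_levelFamiliesOnto stub_B1b_regimeFormsTransportBack stub_B3_towerHodgeSpanning stub_B4_cohIsoOfParts

end Summit.HodgeConjecture.HodgeConjecture.Cruxes.H413.F0P2aHodgeRealisation

end
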